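/-
Copyright: b2b-lace packet (enumeration shard B, gen 12).  THE SHELL LAW of the `W_d`-orbit sum at a (scaled)
indicator vector: for `f` invariant under signed permutations and `r = |S|`,
  `(2^d d!)⁻¹ Σ_{ρ ∈ W_d} f(c·1_S − ρ(c·1_S)) = C(d,r)⁻¹ Σ_{|T| = r} 2^{-|S∩T|} Σ_b C(|S∩T|, b) · f(c · 1^{|S Δ T|} 2^{b})`,
whence computable majorants of `W_{n,j}(1_S)`, `W_{n,j}(2e_i)` from any table of upper bounds of `I_{n,2j}` at the
class representatives.  d-generic; no numeral; no `sorry`.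
-/
import Literature.Probability.FitznerVanDerHofstad2017.SrwIntegralMonotone
import Literature.Probability.FitznerVanDerHofstad2017.SrwIntegralSupFinite
import HarnessLib

/-!
# The shell law of the orbit sum `Σ_{ρ ∈ W_d} f(x − ρx)` at indicator vectors

CITATION HEADER (PLACEMENT v2). This module is part of a certified REPRODUCTION of:
R. Fitzner, R. van der Hofstad, *Mean-field behavior for nearest-neighbor percolation in d > 10*,
Electron. J. Probab. 22 (2017), no. 43 [FvdH17], and *Generalized approach to the non-backtracking lace
expansion*, Probab. Theory Related Fields 169 (2017) 1041–1119 [NoBLE17-I] (arXiv:1506.07977, 1506.07969).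
Reproduces: the COUNTING behind the notebook cells `L[n,x]`, `K[n,l,x]` of `SRW.nb` §2 — the placement
formula (5.16) `W_{n,j}(x) = |W_d|⁻¹ Σ_{ρ ∈ W_d} I_{n,2j}(x − ρx)` evaluated at the class representatives
`x = 1_S` (and `c · 1_S`) as a finite weighted sum over SHELLS `1^{a} 2^{b}` with explicit hypergeometric ×
binomial weights.  Origin: build `lace`, GAPS G8 (δ3) ("meaning of the served K-table"), enumeration shard B
(enum2-g12); consumed by `MeanFieldD11Stage1TabsK` (the `d = 11` certificate).

## What is here (all `d`-generic, [folklore] counting)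

* `sum_comp_div_card_eq_of_transitive` — averaging principle: for `φ : α → β` between finite types whose
  fibres are permuted transitively by self-bijections of `α`, `|α|⁻¹ Σ_a G(φ a) = |β|⁻¹ Σ_b G(b)`;
* `sum_inter_div_eq` — `2^{-d} Σ_{N ⊆ [d]} g(A ∩ N) = 2^{-|A|} Σ_{B ⊆ A} g(B)`;
* `orbitSum_indicatorVec_eq`, `orbitSum_smul_indicatorVec_eq` — the shell law above;
* `srwW_indicatorVec_le_of_shellBound`, `srwW_smul_indicatorVec_le_of_shellBound` — for `d ≥ 2n+1`:
  `W_{n,j}(c·1_S) ≤ C(d,r)⁻¹ Σ_{|T|=r} 2^{-|S∩T|} Σ_b C(|S∩T|,b) B(|SΔT|, b)` for any shell majorant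
  `I_{n,2j}(c·1^a 2^b) ≤ B(a,b)` (`a + b ≤ d`).

## What is NOT here
No dimension, no table, no numeric value; nothing cited beyond the tree's (5.16) (`srwW_eq_orbit_sum`) and the
`W_d`-invariance of `I_{n,l}` (`srwI_spAct`).

## References
* [NoBLE17-I] R. Fitzner, R. van der Hofstad, PTRF 169 (2017) 1041–1119; arXiv:1506.07969 — (5.16) p. 1092,
  notebook `SRW.nb` §2 (arXiv:1506.07977 anc), cells `L[n_,x_]`, `K[n_,l_,x_]`.
-/

namespace Literature.Probability.FitznerVanDerHofstad2017

open Finset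

open scoped symmDiff

variable {d : ℕ}

/-! ### Averaging over a map with transitively permuted fibres -/

section Transitive

variable {α β : Type*} [Fintype α] [Fintype β] [DecidableEq β]

omit [Fintype β] in
/-- If self-bijections of `α` act transitively on the fibres of `φ : α → β`, all fibres have the same size.
[folklore] -/
theorem card_fiber_eq_of_transitive (φ : α → β)
    (htr : ∀ b b' : β, ∃ e : α ≃ α, ∀ a, φ (e a) = b' ↔ φ a = b) (b b' : β) :
    (univ.filter fun a => φ a = b).card = (univ.filter fun a => φ a = b').card := by
  obtain ⟨e, he⟩ := htr b b'
  rw [← Finset.card_map e.toEmbedding]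
  congr 1
  ext x
  simp only [mem_map_equiv, mem_filter, mem_univ, true_and]
  have h := he (e.symm x)
  rw [Equiv.apply_symm_apply] at h
  exact h.symm

/-- **Averaging principle.** `(Σ_a G(φ a)) · |β| = (Σ_b G b) · |α|` when the fibres of `φ` are permuted
transitively by self-bijections of `α`. [folklore] -/
theorem sum_comp_mul_card_eq_of_transitive (φ : α → β)
    (htr : ∀ b b' : β, ∃ e : α ≃ α, ∀ a, φ (e a) = b' ↔ φ a = b) (G : β → ℝ) :
    (∑ a, G (φ a)) * (Fintype.card β : ℝ) = (∑ b, G b) * (Fintype.card α : ℝ) := by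
  have hmaps : ∀ a ∈ (univ : Finset α), φ a ∈ (univ : Finset β) := fun a _ => mem_univ _
  have hsum : ∑ a, G (φ a) = ∑ b, ((univ.filter fun a => φ a = b).card : ℝ) * G b := by
    rw [← sum_fiberwise_of_maps_to hmaps (fun a => G (φ a))]
    refine sum_congr rfl fun b _ => ?_
    rw [sum_congr rfl fun a ha => (by rw [(mem_filter.mp ha).2] : G (φ a) = G b), sum_const, nsmul_eq_mul]
  have hcard : (Fintype.card α : ℝ) = ∑ b, ((univ.filter fun a => φ a = b).card : ℝ) := by
    rw [← Finset.card_univ, card_eq_sum_card_fiberwise hmaps, Nat.cast_sum]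
  rcases isEmpty_or_nonempty β with hβ | ⟨⟨b₀⟩⟩
  · simp
  · have hc : ∀ b, ((univ.filter fun a => φ a = b).card : ℝ) = ((univ.filter fun a => φ a = b₀).card : ℝ) :=
      fun b => by rw [card_fiber_eq_of_transitive φ htr b b₀]
    rw [hsum, hcard]
    simp_rw [hc]
    rw [← mul_sum, sum_const, card_univ, nsmul_eq_mul]
    ring

/-- **Averaging principle, ratio form.** `|α|⁻¹ Σ_a G(φ a) = |β|⁻¹ Σ_b G(b)`. [folklore] -/
theorem sum_comp_div_card_eq_of_transitive [Nonempty α] [Nonempty β] (φ : α → β)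
    (htr : ∀ b b' : β, ∃ e : α ≃ α, ∀ a, φ (e a) = b' ↔ φ a = b) (G : β → ℝ) :
    (∑ a, G (φ a)) / (Fintype.card α : ℝ) = (∑ b, G b) / (Fintype.card β : ℝ) := by
  have hα : (0 : ℝ) < Fintype.card α := Nat.cast_pos.mpr Fintype.card_pos
  have hβ : (0 : ℝ) < Fintype.card β := Nat.cast_pos.mpr Fintype.card_pos
  rw [div_eq_div_iff hα.ne' hβ.ne']
  exact sum_comp_mul_card_eq_of_transitive φ htr G

end Transitive

/-! ### Sign subsets: `2^{-d} Σ_{N} g(A ∩ N) = 2^{-|A|} Σ_{B ⊆ A} g(B)` -/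

/-- Averaging a function of `A ∩ N` over all `N ⊆ [d]` is averaging over the subsets of `A`. [folklore] -/
theorem sum_inter_div_eq (A : Finset (Fin d)) (g : Finset (Fin d) → ℝ) :
    (∑ N : Finset (Fin d), g (A ∩ N)) / (2 : ℝ) ^ d = (∑ B ∈ A.powerset, g B) / (2 : ℝ) ^ A.card := by
  classical
  let φ : Finset (Fin d) → ↥A.powerset := fun N => ⟨A ∩ N, mem_powerset.mpr inter_subset_left⟩
  have htr : ∀ b b' : ↥A.powerset, ∃ e : Finset (Fin d) ≃ Finset (Fin d), ∀ N, φ (e N) = b' ↔ φ N = b := by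
    rintro ⟨B, hB⟩ ⟨B', hB'⟩
    rw [mem_powerset] at hB hB'
    refine ⟨⟨fun N => N ∆ (B ∆ B'), fun N => N ∆ (B ∆ B'), fun N => symmDiff_symmDiff_cancel_right _ _,
      fun N => symmDiff_symmDiff_cancel_right _ _⟩, fun N => ?_⟩
    simp only [φ, Equiv.coe_fn_mk, Subtype.mk.injEq, Finset.ext_iff, mem_inter, mem_symmDiff]
    refine forall_congr' fun μ => ?_
    have h1 : μ ∈ B → μ ∈ A := fun h => hB h
    have h2 : μ ∈ B' → μ ∈ A := fun h => hB' h
    tauto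
  haveI : Nonempty ↥A.powerset := ⟨⟨∅, empty_mem_powerset A⟩⟩
  have key := sum_comp_div_card_eq_of_transitive φ htr (fun B => g B.1)
  rw [Fintype.card_finset, Fintype.card_fin, Fintype.card_coe, card_powerset, Finset.sum_coe_sort A.powerset g]
    at key
  push_cast at key
  exact key

/-! ### The orbit of an indicator vector: `ρ ↦ (π⁻¹S, {δ = -1})` -/

/-- `{μ : π μ ∈ S}` as a `Finset`. [folklore] -/
def prePerm (S : Finset (Fin d)) (π : Equiv.Perm (Fin d)) : Finset (Fin d) := S.map π.symm.toEmbedding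

/-- Membership in `prePerm`. [folklore] -/
theorem mem_prePerm {S : Finset (Fin d)} {π : Equiv.Perm (Fin d)} {μ : Fin d} :
    μ ∈ prePerm S π ↔ π μ ∈ S := by
  unfold prePerm
  rw [mem_map_equiv, Equiv.symm_symm]

/-- `|prePerm S π| = |S|`. [folklore] -/
theorem card_prePerm (S : Finset (Fin d)) (π : Equiv.Perm (Fin d)) : (prePerm S π).card = S.card :=
  card_map _

/-- The set of negative signs `{μ : δ μ = -1}`. [folklore] -/
def negSet (δ : Fin d → ℤˣ) : Finset (Fin d) := univ.filter fun μ => δ μ = -1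

/-- Membership in `negSet`. [folklore] -/
theorem mem_negSet {δ : Fin d → ℤˣ} {μ : Fin d} : μ ∈ negSet δ ↔ δ μ = -1 := by
  simp [negSet]

/-- The signed indicator `±1_T` with signs `-1` exactly on `N`. [folklore] -/
def sgnInd (T N : Finset (Fin d)) : Fin d → ℤ :=
  fun μ => if μ ∈ T then (if μ ∈ N then -1 else 1) else 0

/-- `ρ 1_S = ±1_{π⁻¹ S}` with the signs of `ρ`. [folklore] -/
theorem spAct_indicatorVec (ρ : SgnPermPair d) (S : Finset (Fin d)) :
    spAct ρ (indicatorVec S) = sgnInd (prePerm S ρ.1) (negSet ρ.2) := by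
  funext μ
  rw [spAct_apply, indicatorVec_apply]
  simp only [sgnInd, mem_prePerm, mem_negSet]
  by_cases h : ρ.1 μ ∈ S
  · rw [if_pos h, if_pos h, mul_one]
    rcases Int.units_eq_one_or (ρ.2 μ) with h1 | h1
    · rw [h1, if_neg (by decide)]
      rfl
    · rw [h1, if_pos rfl]
      rfl
  · rw [if_neg h, if_neg h, mul_zero]

/-- The orbit map `ρ = (π, δ) ↦ (π⁻¹ S, {δ = -1})`. [folklore] -/
def orbMap (S : Finset (Fin d)) (ρ : SgnPermPair d) :
    {T : Finset (Fin d) // T.card = S.card} × Finset (Fin d) :=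
  (⟨prePerm S ρ.1, card_prePerm S ρ.1⟩, negSet ρ.2)

/-- Two subsets of the same size are exchanged by a permutation. [folklore] -/
theorem exists_perm_of_card_eq {T T' : Finset (Fin d)} (h : T.card = T'.card) :
    ∃ ν : Equiv.Perm (Fin d), ∀ μ, μ ∈ T' ↔ ν μ ∈ T := by
  obtain ⟨τ, hτ⟩ := exists_spAct_eq_of_card_abs_eq (indicatorVec T) (indicatorVec T') (by
    intro v
    rw [Fintype.card_subtype, Fintype.card_subtype, card_abs_indicatorVec, card_abs_indicatorVec, h])
  refine ⟨τ.1, fun μ => ?_⟩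
  have hμ := congr_fun hτ μ
  rw [spAct_apply, indicatorVec_apply, indicatorVec_apply] at hμ
  rcases Int.units_eq_one_or (τ.2 μ) with hu | hu <;> rw [hu] at hμ <;> push_cast at hμ <;>
    by_cases h1 : τ.1 μ ∈ T <;> by_cases h2 : μ ∈ T' <;> simp [h1, h2] at hμ ⊢

/-- The fibres of the orbit map are permuted transitively by right multiplications. [folklore] -/
theorem orbMap_transitive (S : Finset (Fin d))
    (b b' : {T : Finset (Fin d) // T.card = S.card} × Finset (Fin d)) :
    ∃ e : SgnPermPair d ≃ SgnPermPair d, ∀ ρ, orbMap S (e ρ) = b' ↔ orbMap S ρ = b := by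
  obtain ⟨⟨T, hT⟩, N⟩ := b
  obtain ⟨⟨T', hT'⟩, N'⟩ := b'
  obtain ⟨ν, hν⟩ := exists_perm_of_card_eq (T := T) (T' := T') (hT.trans hT'.symm)
  let ε : Fin d → ℤˣ := fun μ => if (μ ∈ N ↔ μ ∈ N') then 1 else -1
  refine ⟨Equiv.prodCongr (Equiv.mulRight ν) (Equiv.mulRight ε), fun ρ => ?_⟩
  obtain ⟨π, δ⟩ := ρ
  simp only [orbMap, Equiv.prodCongr_apply, Prod.map, Equiv.coe_mulRight, Prod.mk.injEq, Subtype.mk.injEq]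
  refine and_congr ?_ ?_
  · simp only [Finset.ext_iff, mem_prePerm, Equiv.Perm.mul_apply]
    constructor
    · intro h μ
      have h' := h (ν.symm μ)
      rw [Equiv.apply_symm_apply, hν, Equiv.apply_symm_apply] at h'
      exact h'
    · intro h μ
      rw [h (ν μ), hν]
  · simp only [Finset.ext_iff, mem_negSet, Pi.mul_apply]
    refine forall_congr' fun μ => ?_
    have hne : (1 : ℤˣ) ≠ -1 := by decide
    by_cases hNN : (μ ∈ N ↔ μ ∈ N')
    · simp only [ε, if_pos hNN, mul_one]
      tauto
    · simp only [ε, if_neg hNN]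
      rcases Int.units_eq_one_or (δ μ) with hu | hu
      · rw [hu, one_mul]
        have : ¬ ((1 : ℤˣ) = -1) := hne
        tauto
      · rw [hu, neg_one_mul, neg_neg]
        have : ¬ ((1 : ℤˣ) = -1) := hne
        tauto

/-! ### The profile of `1_S ∓ 1_T` -/

/-- Coordinates of `1_S − (±1_T)`: absolute value `2` on `S ∩ T ∩ N`, `1` on `S Δ T`, `0` elsewhere.
[folklore] -/
theorem abs_indicatorVec_sub_sgnInd (S T N : Finset (Fin d)) (μ : Fin d) :
    |(indicatorVec S - sgnInd T N) μ| =
      if μ ∈ S ∩ T ∩ N then 2 else if μ ∈ S ∆ T then 1 else 0 := by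
  simp only [Pi.sub_apply, indicatorVec_apply, sgnInd, mem_inter, mem_symmDiff]
  by_cases hS : μ ∈ S <;> by_cases hT : μ ∈ T <;> by_cases hN : μ ∈ N <;> simp [hS, hT, hN]

/-- `S ∩ T ∩ N` and `S Δ T` are disjoint. [folklore] -/
theorem disjoint_inter_inter_symmDiff (S T N : Finset (Fin d)) : Disjoint (S ∩ T ∩ N) (S ∆ T) := by
  rw [Finset.disjoint_left]
  intro μ h1 h2
  simp only [mem_inter] at h1
  rw [mem_symmDiff] at h2
  tauto

/-- `|S Δ T| + |S ∩ T| = |S ∪ T|`. [folklore] -/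
theorem card_symmDiff_add_card_inter (S T : Finset (Fin d)) :
    (S ∆ T).card + (S ∩ T).card = (S ∪ T).card := by
  rw [symmDiff_eq_sup_sdiff_inf]
  show ((S ∪ T) \ (S ∩ T)).card + (S ∩ T).card = (S ∪ T).card
  have h := card_sdiff_add_card_inter (S ∪ T) (S ∩ T)
  rwa [inter_eq_right.mpr inter_subset_union] at h

/-- `|S Δ T| + |S ∩ T ∩ N| ≤ d`. [folklore] -/
theorem card_symmDiff_add_card_inter_inter_le (S T N : Finset (Fin d)) :
    (S ∆ T).card + (S ∩ T ∩ N).card ≤ d := by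
  calc (S ∆ T).card + (S ∩ T ∩ N).card ≤ (S ∆ T).card + (S ∩ T).card :=
        Nat.add_le_add_left (card_le_card inter_subset_left) _
    _ = (S ∪ T).card := card_symmDiff_add_card_inter S T
    _ ≤ d := by simpa using card_le_univ (S ∪ T)

/-- The profile of `1_S − (±1_T)` is that of the class representative `1^{|SΔT|} 2^{|S∩T∩N|}`. [folklore] -/
theorem card_abs_indicatorVec_sub_sgnInd (S T N : Finset (Fin d)) (v : ℤ) :
    (univ.filter fun μ => |(indicatorVec S - sgnInd T N) μ| = v).card =
      if v = 0 then d - ((S ∆ T).card + (S ∩ T ∩ N).card) else if v = 1 then (S ∆ T).card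
      else if v = 2 then (S ∩ T ∩ N).card else 0 := by
  have hdisj := disjoint_inter_inter_symmDiff S T N
  -- the three level sets
  have e2 : (univ.filter fun μ => |(indicatorVec S - sgnInd T N) μ| = 2) = S ∩ T ∩ N := by
    ext μ
    simp only [mem_filter, mem_univ, true_and, Pi.sub_apply, indicatorVec_apply, sgnInd, mem_inter]
    by_cases hS : μ ∈ S <;> by_cases hT : μ ∈ T <;> by_cases hN : μ ∈ N <;> simp [hS, hT, hN]
  have e1 : (univ.filter fun μ => |(indicatorVec S - sgnInd T N) μ| = 1) = S ∆ T := by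
    ext μ
    simp only [mem_filter, mem_univ, true_and, Pi.sub_apply, indicatorVec_apply, sgnInd, mem_symmDiff]
    by_cases hS : μ ∈ S <;> by_cases hT : μ ∈ T <;> by_cases hN : μ ∈ N <;> simp [hS, hT, hN]
  have e0 : (univ.filter fun μ => |(indicatorVec S - sgnInd T N) μ| = 0) = (S ∩ T ∩ N ∪ S ∆ T)ᶜ := by
    ext μ
    simp only [mem_filter, mem_univ, true_and, Pi.sub_apply, indicatorVec_apply, sgnInd, mem_compl, mem_union,
      mem_inter, mem_symmDiff]
    by_cases hS : μ ∈ S <;> by_cases hT : μ ∈ T <;> by_cases hN : μ ∈ N <;> simp [hS, hT, hN]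
  have e3 : ∀ v : ℤ, v ≠ 0 → v ≠ 1 → v ≠ 2 →
      (univ.filter fun μ => |(indicatorVec S - sgnInd T N) μ| = v) = ∅ := by
    intro v h0 h1 h2
    ext μ
    simp only [mem_filter, mem_univ, true_and, Pi.sub_apply, indicatorVec_apply, sgnInd, Finset.notMem_empty,
      iff_false]
    by_cases hS : μ ∈ S <;> by_cases hT : μ ∈ T <;> by_cases hN : μ ∈ N <;> simp [hS, hT, hN] <;> omega
  by_cases h0 : v = 0
  · subst h0
    rw [if_pos rfl, e0, card_compl, Fintype.card_fin, card_union_of_disjoint hdisj, Nat.add_comm]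
  by_cases h1 : v = 1
  · subst h1
    rw [if_neg h0, if_pos rfl, e1]
  by_cases h2 : v = 2
  · subst h2
    rw [if_neg h0, if_neg h1, if_pos rfl, e2]
  · rw [if_neg h0, if_neg h1, if_neg h2, e3 v h0 h1 h2, card_empty]

/-- For a `W_d`-invariant `f`: `f(1_S − (±1_T)) = f(1^{|SΔT|} 2^{|S∩T∩N|})`. [folklore] -/
theorem apply_indicatorVec_sub_sgnInd (f : (Fin d → ℤ) → ℝ) (hf : ∀ τ z, f (spAct τ z) = f z)
    (S T N : Finset (Fin d)) :
    f (indicatorVec S - sgnInd T N) = f (classVec d (S ∆ T).card (S ∩ T ∩ N).card) := by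
  obtain ⟨τ, hτ⟩ := exists_spAct_eq_of_card_abs_eq (indicatorVec S - sgnInd T N)
    (classVec d (S ∆ T).card (S ∩ T ∩ N).card) (by
      intro v
      rw [Fintype.card_subtype, Fintype.card_subtype, card_abs_indicatorVec_sub_sgnInd,
        card_abs_classVec _ _ (card_symmDiff_add_card_inter_inter_le S T N)])
  rw [← hτ, hf]

/-- The same for the scaled vector `c·1_S − ρ(c·1_S) = c·(1_S − ρ 1_S)`. [folklore] -/
theorem spAct_smul (ρ : SgnPermPair d) (c : ℤ) (z : Fin d → ℤ) : spAct ρ (c • z) = c • spAct ρ z := by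
  funext i
  simp only [spAct_apply, Pi.smul_apply, smul_eq_mul]
  ring

/-! ### The shell law -/

/-- `|W_d| = 2^d · d!` (as a real). [folklore] -/
theorem card_sgnPermPair_real (d : ℕ) :
    (Fintype.card (SgnPermPair d) : ℝ) = 2 ^ d * (d.factorial : ℝ) := by
  rw [Fintype.card_prod, card_perm_fin, card_signs]
  push_cast
  ring

/-- **The shell law of the orbit sum at an indicator vector.**  For `f` invariant under signed permutations
and `r = |S|`:
`(2^d d!)⁻¹ Σ_{ρ ∈ W_d} f(1_S − ρ 1_S) = C(d,r)⁻¹ Σ_{|T| = r} 2^{-|S∩T|} Σ_{b ≤ |S∩T|} C(|S∩T|, b) f(1^{|SΔT|} 2^b)`.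
[cite: FitznerVanDerHofstad2016NoBLE, (5.16) p. 1092] -/
theorem orbitSum_indicatorVec_eq (S : Finset (Fin d)) (f : (Fin d → ℤ) → ℝ)
    (hf : ∀ τ z, f (spAct τ z) = f z) :
    (∑ ρ : SgnPermPair d, f (indicatorVec S - spAct ρ (indicatorVec S))) / (2 ^ d * (d.factorial : ℝ)) =
      (∑ T ∈ powersetCard S.card univ, ((1 : ℝ) / 2) ^ (S ∩ T).card *
          ∑ b ∈ range ((S ∩ T).card + 1),
            (((S ∩ T).card.choose b : ℕ) : ℝ) * f (classVec d (S ∆ T).card b)) / (d.choose S.card : ℝ) := by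
  classical
  -- the parametrised summand
  let F : {T : Finset (Fin d) // T.card = S.card} × Finset (Fin d) → ℝ :=
    fun b => f (indicatorVec S - sgnInd b.1.1 b.2)
  have hF : ∀ ρ : SgnPermPair d, f (indicatorVec S - spAct ρ (indicatorVec S)) = F (orbMap S ρ) := by
    intro ρ
    simp only [F, orbMap, spAct_indicatorVec]
  haveI : Nonempty ({T : Finset (Fin d) // T.card = S.card} × Finset (Fin d)) := ⟨(⟨S, rfl⟩, ∅)⟩
  have step1 : (∑ ρ : SgnPermPair d, f (indicatorVec S - spAct ρ (indicatorVec S))) / (2 ^ d * (d.factorial : ℝ))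
      = (∑ b, F b) / (Fintype.card ({T : Finset (Fin d) // T.card = S.card} × Finset (Fin d)) : ℝ) := by
    rw [← card_sgnPermPair_real, sum_congr rfl fun ρ _ => hF ρ]
    exact sum_comp_div_card_eq_of_transitive (orbMap S) (orbMap_transitive S) F
  have hcardβ : (Fintype.card ({T : Finset (Fin d) // T.card = S.card} × Finset (Fin d)) : ℝ)
      = (d.choose S.card : ℝ) * 2 ^ d := by
    rw [Fintype.card_prod, Fintype.card_finset_len, Fintype.card_finset, Fintype.card_fin]
    push_cast
    ring
  -- inner sums
  have inner : ∀ T : Finset (Fin d), ∑ N : Finset (Fin d), f (indicatorVec S - sgnInd T N) =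
      2 ^ d * (((1 : ℝ) / 2) ^ (S ∩ T).card *
        ∑ b ∈ range ((S ∩ T).card + 1), (((S ∩ T).card.choose b : ℕ) : ℝ) * f (classVec d (S ∆ T).card b)) := by
    intro T
    have h1 : ∀ N : Finset (Fin d), f (indicatorVec S - sgnInd T N) =
        (fun B : Finset (Fin d) => f (classVec d (S ∆ T).card B.card)) (S ∩ T ∩ N) := fun N =>
      apply_indicatorVec_sub_sgnInd f hf S T N
    simp_rw [h1]
    have h2 := sum_inter_div_eq (S ∩ T) (fun B : Finset (Fin d) => f (classVec d (S ∆ T).card B.card))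
    have h2' : ∑ N : Finset (Fin d), f (classVec d (S ∆ T).card (S ∩ T ∩ N).card) =
        2 ^ d * ((∑ B ∈ (S ∩ T).powerset, f (classVec d (S ∆ T).card B.card)) / 2 ^ (S ∩ T).card) := by
      rw [← h2, mul_div_cancel₀ _ (by positivity)]
    rw [h2', Finset.sum_powerset_apply_card (fun b => f (classVec d (S ∆ T).card b)), one_div_pow,
      div_eq_mul_one_div, mul_comm (∑ b ∈ _, _) _]
    congr 2
    refine sum_congr rfl fun b _ => ?_
    rw [nsmul_eq_mul]
  rw [step1, hcardβ, Fintype.sum_prod_type]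
  simp only [F]
  simp_rw [inner]
  rw [← Finset.sum_subtype (powersetCard S.card univ) (p := fun T : Finset (Fin d) => T.card = S.card)
    (fun T => mem_powersetCard_univ)
    (fun T : Finset (Fin d) => (2 : ℝ) ^ d * (((1 : ℝ) / 2) ^ (S ∩ T).card *
      ∑ b ∈ range ((S ∩ T).card + 1), (((S ∩ T).card.choose b : ℕ) : ℝ) * f (classVec d (S ∆ T).card b))),
    ← mul_sum, mul_comm ((d.choose S.card : ℕ) : ℝ) _, mul_div_mul_left _ _ (by positivity)]

/-- **The shell law at a scaled indicator vector** `c·1_S` (e.g. `2e_i = 2·1_{{i}}`). [cite: FitznerVanDerHofstad2016NoBLE, (5.16) p. 1092] -/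
theorem orbitSum_smul_indicatorVec_eq (c : ℤ) (S : Finset (Fin d)) (f : (Fin d → ℤ) → ℝ)
    (hf : ∀ τ z, f (spAct τ z) = f z) :
    (∑ ρ : SgnPermPair d, f (c • indicatorVec S - spAct ρ (c • indicatorVec S))) / (2 ^ d * (d.factorial : ℝ)) =
      (∑ T ∈ powersetCard S.card univ, ((1 : ℝ) / 2) ^ (S ∩ T).card *
          ∑ b ∈ range ((S ∩ T).card + 1),
            (((S ∩ T).card.choose b : ℕ) : ℝ) * f (c • classVec d (S ∆ T).card b)) / (d.choose S.card : ℝ) := by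
  have h : ∀ ρ : SgnPermPair d, f (c • indicatorVec S - spAct ρ (c • indicatorVec S)) =
      (fun z => f (c • z)) (indicatorVec S - spAct ρ (indicatorVec S)) := by
    intro ρ
    simp only [spAct_smul, smul_sub]
  simp_rw [h]
  exact orbitSum_indicatorVec_eq S (fun z => f (c • z)) (fun τ z => by simp only [← spAct_smul, hf])

/-! ### Majorants of `W_{n,j}` at the class representatives -/

/-- **Shell majorant of `W_{n,j}(1_S)`** (`d ≥ 2n+1`): any table `B(a,b) ≥ I_{n,2j}(1^a 2^b)` (`a + b ≤ d`) gives
`W_{n,j}(1_S) ≤ C(d,|S|)⁻¹ Σ_{|T|=|S|} 2^{-|S∩T|} Σ_b C(|S∩T|,b) B(|SΔT|, b)`.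
[cite: FitznerVanDerHofstad2016NoBLE, (5.16) p. 1092] -/
theorem srwW_indicatorVec_le_of_shellBound {n : ℕ} (hd : 2 * n + 1 ≤ d) (j : ℕ) (S : Finset (Fin d))
    (B : ℕ → ℕ → ℝ) (hB : ∀ a b, a + b ≤ d → srwI d n (2 * j) (classVec d a b) ≤ B a b) :
    srwW d n j (indicatorVec S) ≤
      (∑ T ∈ powersetCard S.card univ, ((1 : ℝ) / 2) ^ (S ∩ T).card *
          ∑ b ∈ range ((S ∩ T).card + 1), (((S ∩ T).card.choose b : ℕ) : ℝ) * B (S ∆ T).card b) /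
        (d.choose S.card : ℝ) := by
  rw [srwW_eq_orbit_sum hd, orbitSum_indicatorVec_eq S _ (fun τ z => srwI_spAct n (2 * j) τ z)]
  refine div_le_div_of_nonneg_right (sum_le_sum fun T hT => ?_) (by positivity)
  refine mul_le_mul_of_nonneg_left (sum_le_sum fun b hb => ?_) (by positivity)
  refine mul_le_mul_of_nonneg_left (hB _ _ ?_) (by positivity)
  have hb' : b ≤ (S ∩ T).card := Nat.lt_succ_iff.mp (mem_range.mp hb)
  have := card_symmDiff_add_card_inter S T
  have hu : (S ∪ T).card ≤ d := by simpa using card_le_univ (S ∪ T)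
  omega

/-- **Shell majorant of `W_{n,j}(c·1_S)`** (`d ≥ 2n+1`), from any table `B(a,b) ≥ I_{n,2j}(c·1^a 2^b)`
(`a + b ≤ d`). [cite: FitznerVanDerHofstad2016NoBLE, (5.16) p. 1092] -/
theorem srwW_smul_indicatorVec_le_of_shellBound {n : ℕ} (hd : 2 * n + 1 ≤ d) (j : ℕ) (c : ℤ)
    (S : Finset (Fin d)) (B : ℕ → ℕ → ℝ)
    (hB : ∀ a b, a + b ≤ d → srwI d n (2 * j) (c • classVec d a b) ≤ B a b) :
    srwW d n j (c • indicatorVec S) ≤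
      (∑ T ∈ powersetCard S.card univ, ((1 : ℝ) / 2) ^ (S ∩ T).card *
          ∑ b ∈ range ((S ∩ T).card + 1), (((S ∩ T).card.choose b : ℕ) : ℝ) * B (S ∆ T).card b) /
        (d.choose S.card : ℝ) := by
  rw [srwW_eq_orbit_sum hd, orbitSum_smul_indicatorVec_eq c S _ (fun τ z => srwI_spAct n (2 * j) τ z)]
  refine div_le_div_of_nonneg_right (sum_le_sum fun T hT => ?_) (by positivity)
  refine mul_le_mul_of_nonneg_left (sum_le_sum fun b hb => ?_) (by positivity)
  refine mul_le_mul_of_nonneg_left (hB _ _ ?_) (by positivity)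
  have hb' : b ≤ (S ∩ T).card := Nat.lt_succ_iff.mp (mem_range.mp hb)
  have := card_symmDiff_add_card_inter S T
  have hu : (S ∪ T).card ≤ d := by simpa using card_le_univ (S ∪ T)
  omega

end Literature.Probability.FitznerVanDerHofstad2017
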